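import Summits.Ventures.CertifiedManyBodySolver.Observables.StiffnessApexTransportFermiSeaBoxes
import Literature.MathematicalPhysics.QuantumLattice.HubbardNNNHoppingEnergyDensityMonotone
import Literature.MathematicalPhysics.QuantumLattice.HubbardNNNHoppingEnergyDensityParticleHole
import Literature.MathematicalPhysics.QuantumLattice.HubbardNNNHoppingEnergyDensityConcave
import HarnessLib

/-!
# Ventures/CertifiedManyBodySolver — Observables/StiffnessVirtualStation.lean

HONEST FRAMING: one-sided certified CEILINGS on the uniform flux stiffness (t–t′ f-sum class) at ANY density, read from the TARGET's own ENERGY WINDOW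
(one certified energy FLOOR at a coupling below the target, one certified CAP at or above it) and one kernel Fermi-sea row; every leaf is CONDITIONAL on
the rows it names; a ceiling never speaks to the presence of order; not a `T_c` estimate, not a superconductivity verdict; no number of record. Zero
compute, no definition, no claim node, no `sorry`.

Cell `pub/hubbard-fast` (D-0154 (1)(A) «CERTIFICATE REUSE along parameter paths»), seat `hubbard-fast-reuse-2` g9 (`prover-hubbard-fast-reuse-2-g9-0`), path family
«APEX TRANSPORT», line «VIRTUAL STATION»: the REUSE LEMMA in generic form.

THE POINT. hubbard-obs p2's SHARP `U`-CHORD (`torusLimit_negKinetic_le_uchord`, `Observables/StiffnessChordLeaf.lean`) is the variational row at a certified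
FLOOR `lo₁ ≤ e(1, t′₁, U₁, n)` (`U₁ < U`) TESTED ON THE TARGET STATE `ω_P` (`P = (t′, U)`, density `n`), with the double occupancy eliminated by the target's own
energy `e(1, t′, U, n) = K₁ + t′K₂ + U·D` (`K₁ = e_{Φ(1,0,0)}(ω_P)`, `K₂ = e_{Φ(0,1,0)}(ω_P)`, `D = e_{Φ(0,0,1)}(ω_P)`):
`U·(lo₁ − K₁ − t′₁K₂) ≤ U·U₁·D ≤ U₁·(hi − K₁ − t′K₂)` for any CAP `e(1, t′, U, n) ≤ hi`, i.e.

  `(U·lo₁ − U₁·hi)/(U − U₁) ≤ K₁ + κ·K₂ = e_{Φ(1,κ,0)}(ω_P)`,  `κ = (U·t′₁ − U₁·t′)/(U − U₁)`  (§1).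

So far the tree types this chord only AT certified couplings (`t′ = t′₁ = 0` stations, where `κ = 0`) and then carries the station word UP the `U`-ray (T-mono) or
across `t′` by apex transport (g4/g5 «RAY / MOTT STATION»: a source BELOW the target, lever `κ_A = U₀|t′|/(U − U₀)`). Taken instead AT THE TARGET with the cap
TRANSPORTED DOWN from the next certified coupling `U₂ ≥ U` (`energyDensityTT'_mono_U`; at `n = 1` a `t′ = 0` cap is a cap at every `t′` by evenness +
concavity, §3; at doped densities the caller supplies a cap plane, e.g. the `(8, 7/8, 0)` supergradient cap laws of the j300552 / j300556 nodes), the chord is a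
«VIRTUAL STATION» sitting at the target's own coupling: its value `X(U) = (U₁·hi − U·lo₁)/(U − U₁)` DECREASES with `U` between two certified couplings and its lever is
`κ = U₁|t′|/(U − U₁)` (the LOW source coupling `U₁`, not the station `U₀ < U`). A kernel Fermi-sea row `ℓ₂ ≤ e(1, κ₂, 0, n)` on the far side of `2t′`
(`IsTorusLimitOf.energyDensityTT'_le_meanEnergy_hubbardTTPrime` at coupling `(1, κ₂, 0)`, read on `ω_P`) closes it by affinity of `κ ↦ e_{Φ(1,κ,0)}(ω_P)`:
BOTH members live on the target state — no apex step, no source state, no particle–hole witness ⇒ ALL SIDES, either sign of `t′`, any density.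

* §1 `hoppingFloor_of_targetUChord` — the floor at the chord hopping on the TARGET class (any `t′₁`, any cap `hi`);
* §2 `ObsStiffnessSeqCeilingAt_of_targetUChord_fermiSeaRow_weighted` (functional master, barycentric weights) and the CLEARED point forms
  `…_left_cleared` (`κ₂ < 2t′ ≤ κ`, the `t′ < 0` side for a `t′₁ = 0` source) / `…_right_cleared` (`κ ≤ 2t′ < κ₂`);
* §3 `n = 1`: `energyDensityTT'_halfFilling_cap_of_tPrime_zero_cap_above` (cap at `(0, U₂)`, `U ≤ U₂` ⇒ cap at `(t′, U)`);
* the BOX theorems (four-corner certificates; the cleared word inequality is bilinear in `(U, t′)` under a `t′`-independent cap) are in the companion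
  `Observables/StiffnessVirtualStationBoxes.lean`.

NOT said: nothing here beats an SDP kinetic node AT its own coupling (the chord is an energy-window reading); above the last certified cap of a density the
device is void (no cap to transport); the quality is set by the window `U₁·(cap slack) + U·(floor slack)` over `U − U₁` — low source couplings `U₁` win;
`λ ≠ 0` words are not of this form; no `T > 0`.

References: T. Koma, H. Tasaki, J. Stat. Phys. 76 (1994) 745, §1 [KomaTasaki1994]; D. J. Scalapino, S. R. White, S.-C. Zhang, PRB 47 (1993) 7995, §II
[ScalapinoWhiteZhang1993]; T. Hazra, N. Verma, M. Randeria, PRX 9 (2019) 031049, eqs. (2)–(4) [HazraVermaRanderia2019]; E. H. Lieb, M. Loss, Duke Math. J. 71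
(1993) 337, §8 Theorem 8.2 [LiebLoss1993]; R. B. Griffiths, J. Math. Phys. 7 (1966) 1215, §II [Griffiths1966]; E. H. Lieb, F. Y. Wu, Physica A 321 (2003) 1,
§1 eq. (3) [LiebWuPhysicaA2003].
-/

noncomputable section

namespace Summit.Ventures.CertifiedManyBodySolver.Observables

open Literature.MathematicalPhysics.QuantumLattice
open Literature.MathematicalPhysics.QuantumLattice.ThermodynamicLimit
open Literature.MathematicalPhysics.QuantumFieldTheory
open Literature.Probability.LatticeModels
open Matrix Finset Filter Topology HubbardWave0
open scoped Matrix BigOperators ComplexOrder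

/-! ## §1 The `U`-chord at the target: a floor on the target state's one-body functional at the chord hopping -/

section Chord

variable {t U n t₁ U₁ : ℝ}

/-- **THE VIRTUAL STATION (target-side `U`-chord).** Target `(t′, U)` at density `0 ≤ n < 2`; a certified FLOOR `lo₁ ≤ e(1, t′₁, U₁, n)` at a coupling
`0 ≤ U₁ < U` (any `t′₁`) and a CAP `e(1, t′, U, n) ≤ hi`. Then for every torus limit `ω` of unit `(rectN n L, S^z = 0)`-sector ground states of
`hubbardTorusTT' L 1 t′ U`: `(U·lo₁ − U₁·hi)/(U − U₁) ≤ e_{Φ(1,κ,0)}(ω)` with `κ = (U·t′₁ − U₁·t′)/(U − U₁)` — the variational row at `(t′₁, U₁)` tested on `ω`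
(`IsTorusLimitOf.energyDensityTT'_le_meanEnergy_hubbardTTPrime`) and the energy identity at the target (`IsTorusLimitOf.meanEnergy_hubbardTTPrime_eq_energyDensityTT'`),
the double occupancy eliminated between them (`U·U₁·D` appears in both with nonnegative weights). [cite: KomaTasaki1994, §1] [cite: HazraVermaRanderia2019, eq. (2)] -/
theorem hoppingFloor_of_targetUChord (hU₁0 : 0 ≤ U₁) (hU₁ : U₁ < U) (hn0 : 0 ≤ n) (hn2 : n < 2) {lo₁ hi : ℝ}
    (hfloor : lo₁ ≤ energyDensityTT' 1 t₁ U₁ n) (hcap : energyDensityTT' 1 t U n ≤ hi) :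
    ∀ (ω : InfVolFermionState 2) (Ls : ℕ → ℕ) (ψ : ∀ L, Fock (Orb (FermionTorus 2 L))),
      Tendsto Ls atTop atTop →
      (∀ j, IsGroundStateInSector (hubbardTorusTT' (Ls j) 1 t U) (rectN n (Ls j)) 0 (ψ (Ls j))) →
      (∀ j, star (ψ (Ls j)) ⬝ᵥ ψ (Ls j) = 1) → ω.IsTorusLimitOf ψ Ls →
      (U * lo₁ - U₁ * hi) / (U - U₁) ≤ ω.meanEnergy (hubbardTTPrimeFermionInteraction 1 ((U * t₁ - U₁ * t) / (U - U₁)) 0) 1 := by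
  intro ω Ls ψ hLs hψ h1 hω
  have hU0 : 0 ≤ U := hU₁0.trans hU₁.le
  have hd : 0 < U - U₁ := sub_pos.2 hU₁
  have hN : ∀ j, IsNParticle (rectN n (Ls j)) (ψ (Ls j)) := fun j => ((mem_szSector_iff _ _ _).1 (hψ j).1).1
  -- the variational row at the source coupling, tested on the TARGET state
  have hvar := hω.energyDensityTT'_le_meanEnergy_hubbardTTPrime 1 t₁ hU₁0 hn0 hn2 hLs hN h1
  -- the energy identity at the target
  have heq := hω.meanEnergy_hubbardTTPrime_eq_energyDensityTT' 1 t hU0 hn0 hn2 hLs hψ h1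
  rw [ω.meanEnergy_hubbardTTPrime_eq_coords 1 t₁ U₁] at hvar
  rw [ω.meanEnergy_hubbardTTPrime_eq_coords 1 t U] at heq
  rw [ω.meanEnergy_hubbardTTPrime_eq_coords, div_le_iff₀ hd]
  set K₁ := ω.meanEnergy (hubbardTTPrimeFermionInteraction 1 0 0) 1 with hK₁
  set K₂ := ω.meanEnergy (hubbardTTPrimeFermionInteraction 0 1 0) 1 with hK₂
  set Dd := ω.meanEnergy (hubbardTTPrimeFermionInteraction 0 0 1) 1 with hDd
  have h1' : U * lo₁ ≤ U * K₁ + U * t₁ * K₂ + U * U₁ * Dd := by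
    have := mul_le_mul_of_nonneg_left (hfloor.trans hvar) hU0
    linarith [this, show U * (1 * K₁ + t₁ * K₂ + U₁ * Dd) = U * K₁ + U * t₁ * K₂ + U * U₁ * Dd by ring]
  have h2' : U₁ * K₁ + U₁ * t * K₂ + U * U₁ * Dd ≤ U₁ * hi := by
    have hle : 1 * K₁ + t * K₂ + U * Dd ≤ hi := heq.le.trans (le_of_eq_of_le rfl hcap)
    have := mul_le_mul_of_nonneg_left hle hU₁0
    linarith [this, show U₁ * (1 * K₁ + t * K₂ + U * Dd) = U₁ * K₁ + U₁ * t * K₂ + U * U₁ * Dd by ring]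
  have hκ : (U * t₁ - U₁ * t) / (U - U₁) * (U - U₁) = U * t₁ - U₁ * t := div_mul_cancel₀ _ hd.ne'
  have e : (1 * K₁ + (U * t₁ - U₁ * t) / (U - U₁) * K₂ + 0 * Dd) * (U - U₁) =
      (U * K₁ + U * t₁ * K₂ + U * U₁ * Dd) - (U₁ * K₁ + U₁ * t * K₂ + U * U₁ * Dd) := by
    have : (U * t₁ - U₁ * t) / (U - U₁) * K₂ * (U - U₁) = (U * t₁ - U₁ * t) * K₂ := by
      rw [mul_assoc, mul_comm K₂, ← mul_assoc, hκ]
    linear_combination this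
  rw [e]
  linarith

/-- The same floor with the source at a `t′ = 0` station (`t′₁ = 0`): hopping `κ = −U₁·t′/(U − U₁)`. [cite: KomaTasaki1994, §1] -/
theorem hoppingFloor_of_targetUChord_tp0 (hU₁0 : 0 ≤ U₁) (hU₁ : U₁ < U) (hn0 : 0 ≤ n) (hn2 : n < 2) {lo₁ hi : ℝ}
    (hfloor : lo₁ ≤ energyDensityTT' 1 0 U₁ n) (hcap : energyDensityTT' 1 t U n ≤ hi) :
    ∀ (ω : InfVolFermionState 2) (Ls : ℕ → ℕ) (ψ : ∀ L, Fock (Orb (FermionTorus 2 L))),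
      Tendsto Ls atTop atTop →
      (∀ j, IsGroundStateInSector (hubbardTorusTT' (Ls j) 1 t U) (rectN n (Ls j)) 0 (ψ (Ls j))) →
      (∀ j, star (ψ (Ls j)) ⬝ᵥ ψ (Ls j) = 1) → ω.IsTorusLimitOf ψ Ls →
      (U * lo₁ - U₁ * hi) / (U - U₁) ≤ ω.meanEnergy (hubbardTTPrimeFermionInteraction 1 (-(U₁ * t) / (U - U₁)) 0) 1 := by
  have h := hoppingFloor_of_targetUChord (t₁ := 0) hU₁0 hU₁ hn0 hn2 hfloor hcap
  have e : (U * 0 - U₁ * t) / (U - U₁) = -(U₁ * t) / (U - U₁) := by ring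
  rw [e] at h
  exact h

end Chord

/-! ## §2 The stiffness leaf: virtual station × Fermi-sea row, barycentric weights at the target -/

section Master

variable {t U n t₁ U₁ : ℝ}

/-- **VIRTUAL STATION × FERMI-SEA WEIGHTED BRACKET (any density, functional form).** Target `(t′, U)`, `0 ≤ n < 2`; floor `lo₁ ≤ e(1, t′₁, U₁, n)` at
`0 ≤ U₁ < U`, cap `e(1, t′, U, n) ≤ hi`, chord hopping `κ = (U·t′₁ − U₁·t′)/(U − U₁)` (§1); a free-gas floor `ℓ₂ ≤ e(1, κ₂, 0, n)`; weights `μ₁, μ₂ ≥ 0`,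
`μ₁ + μ₂ = 1`, `μ₁κ + μ₂κ₂ = 2t′`. Then `ObsStiffnessSeqCeilingAt t′ U n c` for every rational `c ≥ −(μ₁·(U·lo₁ − U₁·hi)/(U − U₁) + μ₂ℓ₂)/4`: the one-body functional
of the target state is affine in the hopping, bounded below at `κ` by the chord and at `κ₂` by the torus-limit variational row at coupling `(1, κ₂, 0)`.
[cite: KomaTasaki1994, §1] [cite: ScalapinoWhiteZhang1993, §II] [cite: LiebLoss1993, §8, Theorem 8.2] -/
theorem ObsStiffnessSeqCeilingAt_of_targetUChord_fermiSeaRow_weighted (hU₁0 : 0 ≤ U₁) (hU₁ : U₁ < U)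
    (hn0 : 0 ≤ n) (hn2 : n < 2) {lo₁ hi : ℝ} (hfloor : lo₁ ≤ energyDensityTT' 1 t₁ U₁ n) (hcap : energyDensityTT' 1 t U n ≤ hi)
    {μ₁ μ₂ : ℝ} (hμ₁ : 0 ≤ μ₁) (hμ₂ : 0 ≤ μ₂) (hμ : μ₁ + μ₂ = 1) (κ₂ : ℝ)
    (hκ : μ₁ * ((U * t₁ - U₁ * t) / (U - U₁)) + μ₂ * κ₂ = 2 * t) {ℓ₂ : ℝ} (h₂ : ℓ₂ ≤ energyDensityTT' 1 κ₂ 0 n)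
    (c : ℚ) (hc : -(μ₁ * ((U * lo₁ - U₁ * hi) / (U - U₁)) + μ₂ * ℓ₂) / 4 ≤ ((c : ℚ) : ℝ)) :
    ObsStiffnessSeqCeilingAt t U n c := by
  intro ρs θ₀ _ hθ₀ Ls hLs hst
  refine fluxStiffness_le_of_torusLimitTT'_oddMoment_orbit_certificate_seq t (U := U) (δ := 1 - n) (q := ((c : ℚ) : ℝ)) 0
    Finset.univ Finset.univ_nonempty (by linarith) (by linarith) hθ₀ hLs hst ?_
  intro ω Ms ψ hMs hψ h1 hω
  have hψ' : ∀ j, IsGroundStateInSector (hubbardTorusTT' (Ms j) 1 t U) (rectN n (Ms j)) 0 (ψ (Ms j)) := fun j => by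
    simpa only [sub_sub_cancel] using hψ j
  have hN : ∀ j, IsNParticle (rectN n (Ms j)) (ψ (Ms j)) := fun j => ((mem_szSector_iff _ _ _).1 (hψ' j).1).1
  rw [orbitMean_rotOddMomentLimitFunctionalTT_lam_zero_eq_meanEnergy_twice_tPrime hω.isTranslationInvariant]
  -- the chord floor on the TARGET state at the hopping `κ`
  have hch := hoppingFloor_of_targetUChord hU₁0 hU₁ hn0 hn2 hfloor hcap ω Ms ψ hMs hψ' h1 hω
  -- the Fermi-sea row, read on the TARGET state
  have hfs := hω.energyDensityTT'_le_meanEnergy_hubbardTTPrime 1 κ₂ (U := 0) le_rfl hn0 hn2 hMs hN h1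
  set κ : ℝ := (U * t₁ - U₁ * t) / (U - U₁) with hκdef
  have e₁ := ω.meanEnergy_hubbardTTPrime_eq_coords 1 κ 0
  have e₂ := ω.meanEnergy_hubbardTTPrime_eq_coords 1 κ₂ 0
  have eP := ω.meanEnergy_hubbardTTPrime_eq_coords 1 (2 * t) 0
  have haff : ω.meanEnergy (hubbardTTPrimeFermionInteraction 1 (2 * t) 0) 1 =
      μ₁ * ω.meanEnergy (hubbardTTPrimeFermionInteraction 1 κ 0) 1 +
        μ₂ * ω.meanEnergy (hubbardTTPrimeFermionInteraction 1 κ₂ 0) 1 := by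
    rw [e₁, e₂, eP, ← hκ]
    linear_combination (ω.meanEnergy (hubbardTTPrimeFermionInteraction 1 0 0) 1) * hμ.symm
  have hw₁ := mul_le_mul_of_nonneg_left hch hμ₁
  have hw₂ := mul_le_mul_of_nonneg_left (h₂.trans hfs) hμ₂
  have hc' : -(μ₁ * ((U * lo₁ - U₁ * hi) / (U - U₁)) + μ₂ * ℓ₂) / 4 ≤ ((c : ℚ) : ℝ) := hc
  rw [haff]
  linarith

/-- **CLEARED, Fermi-sea row LEFT of the target hopping** (`κ₂ < 2t′ ≤ κ`; the `t′ ≤ 0` side of a `t′₁ = 0` source). With `K = U·t′₁ − U₁·t′`, `d = U − U₁` (`κ = K/d`): if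
`2t′d ≤ K`, `κ₂ < 2t′` and `0 ≤ 4c(K − κ₂d) + (2t′ − κ₂)(U·lo₁ − U₁·hi) + ℓ₂(K − 2t′d)`, then `ObsStiffnessSeqCeilingAt t′ U n c` (weights `μ₁ = (2t′ − κ₂)d/(K − κ₂d)`,
`μ₂ = (K − 2t′d)/(K − κ₂d)`, denominators cleared). [cite: KomaTasaki1994, §1] [cite: ScalapinoWhiteZhang1993, §II] [cite: LiebLoss1993, §8, Theorem 8.2] -/
theorem ObsStiffnessSeqCeilingAt_of_targetUChord_fermiSeaRow_left_cleared (hU₁0 : 0 ≤ U₁) (hU₁ : U₁ < U)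
    (hn0 : 0 ≤ n) (hn2 : n < 2) {lo₁ hi : ℝ} (hfloor : lo₁ ≤ energyDensityTT' 1 t₁ U₁ n) (hcap : energyDensityTT' 1 t U n ≤ hi)
    {κ₂ ℓ₂ : ℝ} (h₂ : ℓ₂ ≤ energyDensityTT' 1 κ₂ 0 n)
    (hbr : 2 * t * (U - U₁) ≤ U * t₁ - U₁ * t) (hτ : κ₂ < 2 * t) (c : ℚ)
    (hc : 0 ≤ 4 * ((c : ℚ) : ℝ) * ((U * t₁ - U₁ * t) - κ₂ * (U - U₁)) +
      (2 * t - κ₂) * (U * lo₁ - U₁ * hi) + ℓ₂ * ((U * t₁ - U₁ * t) - 2 * t * (U - U₁))) :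
    ObsStiffnessSeqCeilingAt t U n c := by
  have hd : 0 < U - U₁ := sub_pos.2 hU₁
  have hE : 0 < (U * t₁ - U₁ * t) - κ₂ * (U - U₁) := by nlinarith
  have hκd : (U * t₁ - U₁ * t) / (U - U₁) * (U - U₁) = U * t₁ - U₁ * t := div_mul_cancel₀ _ hd.ne'
  refine ObsStiffnessSeqCeilingAt_of_targetUChord_fermiSeaRow_weighted hU₁0 hU₁ hn0 hn2 hfloor hcap
    (μ₁ := (2 * t - κ₂) * (U - U₁) / ((U * t₁ - U₁ * t) - κ₂ * (U - U₁)))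
    (μ₂ := ((U * t₁ - U₁ * t) - 2 * t * (U - U₁)) / ((U * t₁ - U₁ * t) - κ₂ * (U - U₁)))
    (div_nonneg (mul_nonneg (by linarith) hd.le) hE.le) (div_nonneg (by linarith) hE.le) ?_ κ₂ ?_ h₂ c ?_
  · rw [← add_div, div_eq_one_iff_eq hE.ne']; ring
  · rw [div_mul_eq_mul_div, div_mul_eq_mul_div, ← add_div, div_eq_iff hE.ne']
    have e : (2 * t - κ₂) * (U - U₁) * ((U * t₁ - U₁ * t) / (U - U₁)) = (2 * t - κ₂) * (U * t₁ - U₁ * t) := by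
      rw [mul_assoc, mul_comm (U - U₁), hκd]
    rw [e]; ring
  · have key : (2 * t - κ₂) * (U - U₁) / ((U * t₁ - U₁ * t) - κ₂ * (U - U₁)) * ((U * lo₁ - U₁ * hi) / (U - U₁)) +
        ((U * t₁ - U₁ * t) - 2 * t * (U - U₁)) / ((U * t₁ - U₁ * t) - κ₂ * (U - U₁)) * ℓ₂ =
        ((2 * t - κ₂) * (U * lo₁ - U₁ * hi) + ℓ₂ * ((U * t₁ - U₁ * t) - 2 * t * (U - U₁))) /
          ((U * t₁ - U₁ * t) - κ₂ * (U - U₁)) := by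
      have hd' : U - U₁ ≠ 0 := hd.ne'
      have hE' : (U * t₁ - U₁ * t) - κ₂ * (U - U₁) ≠ 0 := hE.ne'
      field_simp
    rw [key]
    have hN : -(4 * ((c : ℚ) : ℝ)) * ((U * t₁ - U₁ * t) - κ₂ * (U - U₁)) ≤
        (2 * t - κ₂) * (U * lo₁ - U₁ * hi) + ℓ₂ * ((U * t₁ - U₁ * t) - 2 * t * (U - U₁)) := by
      linarith
    have hNE := (le_div_iff₀ hE).2 hN
    linarith

/-- **CLEARED, Fermi-sea row RIGHT of the target hopping** (`κ ≤ 2t′ < κ₂`; the `t′ ≥ 0` side of a `t′₁ = 0` source). With `K = U·t′₁ − U₁·t′`, `d = U − U₁`: if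
`K ≤ 2t′d`, `2t′ < κ₂` and `0 ≤ 4c(κ₂d − K) + (κ₂ − 2t′)(U·lo₁ − U₁·hi) + ℓ₂(2t′d − K)`, then `ObsStiffnessSeqCeilingAt t′ U n c` (weights `μ₁ = (κ₂ − 2t′)d/(κ₂d − K)`,
`μ₂ = (2t′d − K)/(κ₂d − K)`). [cite: KomaTasaki1994, §1] [cite: ScalapinoWhiteZhang1993, §II] [cite: LiebLoss1993, §8, Theorem 8.2] -/
theorem ObsStiffnessSeqCeilingAt_of_targetUChord_fermiSeaRow_right_cleared (hU₁0 : 0 ≤ U₁) (hU₁ : U₁ < U)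
    (hn0 : 0 ≤ n) (hn2 : n < 2) {lo₁ hi : ℝ} (hfloor : lo₁ ≤ energyDensityTT' 1 t₁ U₁ n) (hcap : energyDensityTT' 1 t U n ≤ hi)
    {κ₂ ℓ₂ : ℝ} (h₂ : ℓ₂ ≤ energyDensityTT' 1 κ₂ 0 n)
    (hbr : U * t₁ - U₁ * t ≤ 2 * t * (U - U₁)) (hτ : 2 * t < κ₂) (c : ℚ)
    (hc : 0 ≤ 4 * ((c : ℚ) : ℝ) * (κ₂ * (U - U₁) - (U * t₁ - U₁ * t)) +
      (κ₂ - 2 * t) * (U * lo₁ - U₁ * hi) + ℓ₂ * (2 * t * (U - U₁) - (U * t₁ - U₁ * t))) :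
    ObsStiffnessSeqCeilingAt t U n c := by
  have hd : 0 < U - U₁ := sub_pos.2 hU₁
  have hE : 0 < κ₂ * (U - U₁) - (U * t₁ - U₁ * t) := by nlinarith
  have hκd : (U * t₁ - U₁ * t) / (U - U₁) * (U - U₁) = U * t₁ - U₁ * t := div_mul_cancel₀ _ hd.ne'
  refine ObsStiffnessSeqCeilingAt_of_targetUChord_fermiSeaRow_weighted hU₁0 hU₁ hn0 hn2 hfloor hcap
    (μ₁ := (κ₂ - 2 * t) * (U - U₁) / (κ₂ * (U - U₁) - (U * t₁ - U₁ * t)))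
    (μ₂ := (2 * t * (U - U₁) - (U * t₁ - U₁ * t)) / (κ₂ * (U - U₁) - (U * t₁ - U₁ * t)))
    (div_nonneg (mul_nonneg (by linarith) hd.le) hE.le) (div_nonneg (by linarith) hE.le) ?_ κ₂ ?_ h₂ c ?_
  · rw [← add_div, div_eq_one_iff_eq hE.ne']; ring
  · rw [div_mul_eq_mul_div, div_mul_eq_mul_div, ← add_div, div_eq_iff hE.ne']
    have e : (κ₂ - 2 * t) * (U - U₁) * ((U * t₁ - U₁ * t) / (U - U₁)) = (κ₂ - 2 * t) * (U * t₁ - U₁ * t) := by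
      rw [mul_assoc, mul_comm (U - U₁), hκd]
    rw [e]; ring
  · have key : (κ₂ - 2 * t) * (U - U₁) / (κ₂ * (U - U₁) - (U * t₁ - U₁ * t)) * ((U * lo₁ - U₁ * hi) / (U - U₁)) +
        (2 * t * (U - U₁) - (U * t₁ - U₁ * t)) / (κ₂ * (U - U₁) - (U * t₁ - U₁ * t)) * ℓ₂ =
        ((κ₂ - 2 * t) * (U * lo₁ - U₁ * hi) + ℓ₂ * (2 * t * (U - U₁) - (U * t₁ - U₁ * t))) /
          (κ₂ * (U - U₁) - (U * t₁ - U₁ * t)) := by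
      have hd' : U - U₁ ≠ 0 := hd.ne'
      have hE' : κ₂ * (U - U₁) - (U * t₁ - U₁ * t) ≠ 0 := hE.ne'
      field_simp
    rw [key]
    have hN : -(4 * ((c : ℚ) : ℝ)) * (κ₂ * (U - U₁) - (U * t₁ - U₁ * t)) ≤
        (κ₂ - 2 * t) * (U * lo₁ - U₁ * hi) + ℓ₂ * (2 * t * (U - U₁) - (U * t₁ - U₁ * t)) := by
      linarith
    have hNE := (le_div_iff₀ hE).2 hN
    linarith

end Master

/-! ## §3 Cap transport to the target: down the `U`-ray (any density); from the `t′ = 0` column at half filling -/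

/-- **A cap transports DOWN the `U`-ray** (`e` is non-decreasing in `U`, `energyDensityTT'_mono_U`): `e(1, t′, U₂, n) ≤ hi`, `0 ≤ U ≤ U₂` ⇒ `e(1, t′, U, n) ≤ hi`.
[cite: Griffiths1966, §II] -/
theorem energyDensityTT'_cap_of_cap_above (t : ℝ) {n U U₂ hi : ℝ} (hn0 : 0 ≤ n) (hn2 : n < 2) (hU : 0 ≤ U) (hle : U ≤ U₂)
    (hcap : energyDensityTT' 1 t U₂ n ≤ hi) : energyDensityTT' 1 t U n ≤ hi :=
  (energyDensityTT'_mono_U 1 t hn0 hn2 hU hle).trans hcap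

/-- **Half filling: a `t′ = 0` cap at a coupling `U₂ ≥ U` is a cap at `(t′, U)` for every `t′`** — `e(1, ·, U, 1)` is even (particle–hole,
`energyDensityTT'_particleHole`) and concave (`concaveOn_energyDensityTT'_tPrime`), hence maximal at `t′ = 0`; then `energyDensityTT'_mono_U`.
[cite: LiebWuPhysicaA2003, §1 eq. (3)] [cite: Griffiths1966, §II] -/
theorem energyDensityTT'_halfFilling_cap_of_tPrime_zero_cap_above (t : ℝ) {U U₂ hi : ℝ} (hU : 0 ≤ U) (hle : U ≤ U₂)
    (hcap : energyDensityTT' 1 0 U₂ 1 ≤ hi) : energyDensityTT' 1 t U 1 ≤ hi := by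
  have hconc := concaveOn_energyDensityTT'_tPrime 1 hU (n := 1) (by norm_num) (by norm_num)
  have ha : (0 : ℝ) ≤ 1 / 2 := by norm_num
  have hab : (1 / 2 : ℝ) + 1 / 2 = 1 := by norm_num
  have hc := hconc.2 (Set.mem_univ t) (Set.mem_univ (-t)) ha ha hab
  have h0 : (1 / 2 : ℝ) * t + 1 / 2 * -t = 0 := by ring
  simp only [smul_eq_mul] at hc
  rw [h0] at hc
  have hph := energyDensityTT'_particleHole 1 t hU (n := 1) (by norm_num) (by norm_num)
  rw [show (2 : ℝ) - 1 = 1 by norm_num] at hph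
  have hmono := energyDensityTT'_mono_U 1 0 (n := 1) (by norm_num) (by norm_num) hU hle
  linarith

end Summit.Ventures.CertifiedManyBodySolver.Observables

end
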